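import Summits.MatrixMultiplication.OmegaCensus.STPPCrossReadingCosetClashTools
import Summits.MatrixMultiplication.OmegaCensus.STPPKernelListerOrderN42DP2
import Summits.MatrixMultiplication.OmegaCensus.STPPKernelListerFilterBridge

/-!
# ω-census (abelian STPP census): order `42` — cross-reading coset-clash kills and the reduced conditional capstone (kernel)

HONEST FRAMING (pub-omega census; verbatim): lottery ticket; floor = certified bounds/negative ranges.
Census STRUCTURE (seat pub-omega-stpp-2 gen 31, 2026-08-29), family (b2).  GENERATED (HOME `pub-omega-stpp-2-g31/code/gen_clash.py`) from the python
detector `code/clash.py` over the kernel lister's dead list `deadN42` (3 patterns): for each pattern with a cross-reading coset clash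
(`STPPCrossReadingCosetClash.lean`: two Kneser-pinned readings put one small set in cosets of subgroups of coprime orders — rule R1 — or two sets of one
block in cosets of the Hall-unique subgroup of order `q` while their difference set has `> q` elements — rule R2) an `H`-generic kill
`no_isSTPP_card42_<pattern>` (side conditions by `decide`); together with the N19/N20/N11 bridges (`STPPKernelListerFilterBridge.lean`) the conditional
capstone `volume_le_of_card_eq_42_of_dead` shrinks to the residual list `deadN42c` (2 of 3 patterns).  Killed here by clash:
`111_233_234`.  Nothing here is progress on `ω`.

References: M. Kneser, Math. Z. 58 (1953); H. Cohn, R. Kleinberg, B. Szegedy, C. Umans, FOCS 2005 (arXiv:math/0511460), Def. 5.1.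
-/

open Finset
open scoped Pointwise

namespace Summit.MatrixMultiplication.OmegaCensus.CubeNB

open Literature.Computability.AlgebraicComplexity
open Literature.Combinatorics.Additive
open Summit.MatrixMultiplication.OmegaCensus.STPPKneser

variable {H : Type*} [AddCommGroup H] [DecidableEq H] [Fintype H]

/-- **`{(1, 1, 1),(2, 3, 3),(2, 3, 4)}` has no STPP realisation in any abelian group of order `42`** (cross-reading coset clash `R1`).
[cite: Kneser1953] [cite: CohnKleinbergSzegedyUmans2005, Def. 5.1] -/
theorem no_isSTPP_card42_111_233_234 (hH : Fintype.card H = 42) (A B C : Fin 3 → Finset H) (hS : IsSTPP A B C)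
    (hA : ∀ i, #(A i) = ![1, 2, 2] i) (hB : ∀ i, #(B i) = ![1, 3, 3] i) (hC : ∀ i, #(C i) = ![1, 3, 4] i) : False := by
  have hAne : ∀ i, (A i).Nonempty := fun i => card_pos.1 (by rw [hA]; fin_cases i <;> simp)
  have hBne : ∀ i, (B i).Nonempty := fun i => card_pos.1 (by rw [hB]; fin_cases i <;> simp)
  have hCne : ∀ i, (C i).Nonempty := fun i => card_pos.1 (by rw [hC]; fin_cases i <;> simp)
  obtain ⟨K1, hK1, hK1q, t1, -, hs1⟩ := exists_carrier_middle_subset_coset' hS hAne hBne hCne 1 ⟨2, by decide⟩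
    (n := 42) (q := 3) (z := 9) (b := 3) (vol := 18) (a := 2) (L := 13) hH
    (by simp only [hA]; decide) (by simp only [hB]; decide) (by simp only [hA, hB, hC]; decide)
    (by simp only [hA, hC]; decide) (by simp only [hB, hC]; decide) (by decide)
  have hsub1 : B 1 ⊆ t1 +ᵥ K1 := hs1
  obtain ⟨K2, hK2, hK2q, y2, hY2⟩ := exists_carrier_DU_subset_coset' (stpp_rotate (stpp_rotate hS)) hCne hAne hBne 2 ⟨0, by decide⟩
    (n := 42) (q' := 7) (z := 10) (b := 2) (vol := 24) (a := 4) (L := 7) hH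
    (by simp only [hC]; decide) (by simp only [hA]; decide) (by simp only [hA, hB, hC]; decide)
    (by simp only [hB, hC]; decide) (by simp only [hA, hB]; decide) (by decide)
  obtain ⟨w2, hw2⟩ := hAne 1
  have hs2 := last_subset_coset_of_DU hK2 (show (1 : Fin 3) ≠ 2 by decide) hY2 hw2
  have hsub2 : B 1 ⊆ (y2 + w2) +ᵥ K2 := hs2
  have h0 : K1 ∩ K2 = {0} := inter_eq_zero_of_coprime hK1 hK2 (by rw [hK1q, hK2q]; decide)
  have hle := card_le_one_of_subset_cosets hK1 hK2 h0 hsub1 hsub2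
  rw [hB] at hle
  exact absurd hle (by decide)

/-- `111_233_234` is not realisable in any abelian group of order `42`. [cite: CohnKleinbergSzegedyUmans2005, Def. 5.1] -/
theorem notRealizable_card42_111_233_234 (hH : Fintype.card H = 42) : ¬ KLister.Realizable H ([(1, 1, 1), (2, 3, 3), (2, 3, 4)] : List KLister.Shape) := by
  intro h
  obtain ⟨A, B, C, hS, hc⟩ := h.out
  exact no_isSTPP_card42_111_233_234 hH A B C hS (fun i => by fin_cases i <;> exact (hc _).2.2.2.1)
    (fun i => by fin_cases i <;> exact (hc _).2.2.2.2.1) (fun i => by fin_cases i <;> exact (hc _).2.2.2.2.2)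

end Summit.MatrixMultiplication.OmegaCensus.CubeNB

namespace Summit.MatrixMultiplication.OmegaCensus.KLister

open Literature.Computability.AlgebraicComplexity
open Summit.MatrixMultiplication.OmegaCensus.CubeNB

/-- Residual dead list at order `42`: `deadN42` minus the patterns killed by coset clashes / tree filters. [folklore] -/
def deadN42c : List (List Shape) :=
  [[(2, 3, 3), (3, 3, 3)],
   [(2, 2, 3), (2, 4, 2), (4, 2, 2)]]

/-- **Order `42` conditional capstone, residual list of 2** (was 3). [cite: CohnKleinbergSzegedyUmans2005, Def. 5.1] -/
theorem volume_le_of_card_eq_42_of_dead_c {H : Type*} [AddCommGroup H] [Fintype H] [DecidableEq H] (hH : Fintype.card H = 42)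
    (hdead : ∀ D ∈ deadN42c, ¬ Realizable H D)
    {m : ℕ} (A B C : Fin m → Finset H) (hS : IsSTPP A B C) : ∑ i, #(A i) * #(B i) * #(C i) ≤ 42 := by
  refine volume_le_of_card_eq_42_of_dead hH ?_ A B C hS
  intro D hD
  simp only [deadN42, List.mem_cons, List.not_mem_nil, or_false] at hD
  rcases hD with rfl | rfl | rfl
  · exact hdead _ (by simp [deadN42c])
  · exact notRealizable_card42_111_233_234 hH
  · exact hdead _ (by simp [deadN42c])

end Summit.MatrixMultiplication.OmegaCensus.KLister
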